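import Summits.RiemannHypothesis.RiemannHypothesis.Theorems.EvenSectorBartaEvenOneSignedWindowsContinuity
import HarnessLib

/-!
# `EvenOneSignedWindows` — the EDGE CHANNEL under a Hadamard-type edge law (pub-rhpf-pf, PF.md §14.9)

**long-odds MECHANISM SEARCH; no RH claims.**  Of the three channels through which a one-signed
windowed ground state can lose its sign as the window `[-a, a]` grows — (E) a zero entering through
the EDGE, (I) an interior double zero, (M) loss of simplicity (`hup` of
`evenOneSignedWindows_of_continuityRoute` excludes all three locally) — this file types the
mechanism that would SEAL channel (E), and proves the (trivial) real analysis that carries it.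

Hypothesis shape (NOT proved here, not known for the Weil form; see PF.md §14.9 for the DATA and
the literature it is modelled on):

* `HadamardEdgeLaw ε τ κ a₀` — a HADAMARD-TYPE SHAPE DERIVATIVE for the window bottom
  `ε = ε₁(a)`: `HasDerivAt ε (-(κ * τ a ^ 2)) a` at every `a ≥ a₀`, with `κ > 0` and `τ a` an
  "edge trace" of the ground state of the window `a`. Model: the fractional Hadamard formula
  `θ'(0) = -Γ(1+s)² ∫_{∂Ω} (u/δ^s)² X·ν` for the first Dirichlet eigenvalue of `(-Δ)^s`
  (Djitte–Fall–Weth, Calc. Var. PDE 60 (2021), Thm 1.1 / Cor. 1.2, arXiv:2002.07719), whose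
  order-zero (logarithmic) analogue would carry the trace `τ = lim u · (−log δ)^{1/2}` suggested by
  the boundary decay `O((−log δ)^{−t})`, all `t < 1/2`, of Dirichlet solutions of the logarithmic
  Laplacian (Chen–Weth, Comm. PDE 44 (2019), Thm 1.11, arXiv:1710.03416). In one dimension and in
  the even sector the shape form is RANK ONE, so a state with vanishing trace is STATIONARY under
  window growth: edge births happen exactly at critical windows.
* `NoCriticalWindow ε a₀` — the window bottom has NO CRITICAL WINDOW: `deriv ε a ≠ 0` for all
  `a ≥ a₀`.

Conclusion (`edgeTrace_pos_of_noCriticalWindow`): if moreover `τ` is continuous on `[a₀, ∞)` and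
positive at `a₀`, then `τ a > 0` for every `a ≥ a₀` — no zero is ever born at the edge. This is an
intermediate-value argument and nothing more; channels (I) and (M) are untouched, and nothing here
implies `EvenOneSignedWindows`, let alone RH. The typed statement is what the cell's dataset tests
(PF.md §14.9: the ratio `θ_N² ln(0.1N) / (−dε₁/da)` and the predicted critical windows of the
control families at their edge births).
-/

set_option linter.dupNamespace false

noncomputable section

open Set Filter
open scoped Real Topology

namespace Summit.RiemannHypothesis.RiemannHypothesis.Theorems.PolarPerronFrobenius

/-- HADAMARD-TYPE EDGE LAW on `[a₀, ∞)`: the window bottom `ε` is differentiable at every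
`a ≥ a₀` with derivative `-(κ · τ(a)²)`, `κ > 0` (PF.md §14.9). A DEFINITION used only as an
explicit hypothesis — posited, not a fact. [folklore] -/
def HadamardEdgeLaw (ε τ : ℝ → ℝ) (κ a₀ : ℝ) : Prop :=
  0 < κ ∧ ∀ a, a₀ ≤ a → HasDerivAt ε (-(κ * τ a ^ 2)) a

/-- NO CRITICAL WINDOW on `[a₀, ∞)`: the window bottom is nowhere stationary (PF.md §14.9).
A DEFINITION used only as an explicit hypothesis — posited, not a fact. [folklore] -/
def NoCriticalWindow (ε : ℝ → ℝ) (a₀ : ℝ) : Prop :=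
  ∀ a, a₀ ≤ a → deriv ε a ≠ 0

/-- Under a Hadamard-type edge law, a window is critical exactly when its edge trace vanishes
(the shape form is rank one: zero trace ⇒ zero slope, and conversely since `κ > 0`). -/
theorem deriv_eq_zero_iff_edgeTrace_eq_zero {ε τ : ℝ → ℝ} {κ a₀ a : ℝ}
    (hlaw : HadamardEdgeLaw ε τ κ a₀) (ha : a₀ ≤ a) : deriv ε a = 0 ↔ τ a = 0 := by
  rw [(hlaw.2 a ha).deriv, neg_eq_zero, mul_eq_zero, or_iff_right hlaw.1.ne']
  exact sq_eq_zero_iff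

/-- Under a Hadamard-type edge law the window bottom is antitone on `[a₀, ∞)` (for the Weil form
this much is PROVED unconditionally in the tree: `weilEvenGroundEnergy_antitone`). -/
theorem antitoneOn_of_hadamardEdgeLaw {ε τ : ℝ → ℝ} {κ a₀ : ℝ} (hlaw : HadamardEdgeLaw ε τ κ a₀) :
    AntitoneOn ε (Ici a₀) := by
  have hderiv : ∀ x ∈ Ici a₀, HasDerivAt ε (-(κ * τ x ^ 2)) x := fun x hx ↦ hlaw.2 x hx
  refine antitoneOn_of_deriv_nonpos (convex_Ici a₀)
    (fun x hx ↦ (hderiv x hx).continuousAt.continuousWithinAt)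
    (fun x hx ↦ (hderiv x (interior_subset hx)).differentiableAt.differentiableWithinAt) ?_
  intro x hx
  rw [(hderiv x (interior_subset hx)).deriv, neg_nonpos]
  exact mul_nonneg hlaw.1.le (sq_nonneg _)

/-- **The edge channel is sealed by the absence of critical windows.** Under a Hadamard-type edge
law on `[a₀, ∞)`, if the window bottom has no critical window, the edge trace is continuous on
`[a₀, ∞)` and positive at `a₀`, then the edge trace is positive at EVERY window `a ≥ a₀`: no zero of
the ground state is ever born at the edge. (Intermediate value theorem; channels (I), (M) of the
continuity route are not addressed.) -/
theorem edgeTrace_pos_of_noCriticalWindow {ε τ : ℝ → ℝ} {κ a₀ : ℝ}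
    (hlaw : HadamardEdgeLaw ε τ κ a₀) (hcrit : NoCriticalWindow ε a₀)
    (hcont : ContinuousOn τ (Ici a₀)) (hstart : 0 < τ a₀) :
    ∀ a, a₀ ≤ a → 0 < τ a := by
  intro a ha
  have hne : ∀ b, a₀ ≤ b → τ b ≠ 0 := fun b hb h ↦
    hcrit b hb ((deriv_eq_zero_iff_edgeTrace_eq_zero hlaw hb).2 h)
  rcases lt_or_lt_iff_ne.mpr (hne a ha) with hlt | hpos
  · -- intermediate value theorem on `[a₀, a]`: a sign change would force a zero of the trace
    exfalso
    have hivt : Icc (τ a) (τ a₀) ⊆ τ '' Icc a₀ a :=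
      intermediate_value_Icc' ha (hcont.mono Icc_subset_Ici_self)
    obtain ⟨c, hc, hc0⟩ := hivt ⟨hlt.le, hstart.le⟩
    exact hne c hc.1 hc0
  · exact hpos

/-- Contrapositive reading for the control families (PF.md §14.9, prediction P-E6): under a
Hadamard-type edge law, a window at which the edge trace changes sign between `a₀` and `a` forces a
CRITICAL WINDOW in `[a₀, a]`. -/
theorem exists_criticalWindow_of_edgeTrace_sign_change {ε τ : ℝ → ℝ} {κ a₀ a : ℝ}
    (hlaw : HadamardEdgeLaw ε τ κ a₀) (ha : a₀ ≤ a) (hcont : ContinuousOn τ (Icc a₀ a))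
    (hstart : 0 < τ a₀) (hend : τ a < 0) : ∃ c ∈ Icc a₀ a, deriv ε c = 0 := by
  have hivt : Icc (τ a) (τ a₀) ⊆ τ '' Icc a₀ a := intermediate_value_Icc' ha hcont
  obtain ⟨c, hc, hc0⟩ := hivt ⟨hend.le, hstart.le⟩
  exact ⟨c, hc, (deriv_eq_zero_iff_edgeTrace_eq_zero hlaw hc.1).2 hc0⟩

end Summit.RiemannHypothesis.RiemannHypothesis.Theorems.PolarPerronFrobenius

end
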